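import Mathlib
import HarnessLib
import Summits.Ventures.LatticeQCDFlow.Exactness.NCMCGeneralSpaceErgodicRun
import Summits.Ventures.LatticeQCDFlow.Exactness.NCMCGeneralSpaceBennettRootConsistency

/-!
# Correlated starts, Crooks pairs: `ΔF̂`, reweighted observables and the Bennett root along ONE ergodic stream

HONEST FRAMING: exact (Metropolis-corrected) sampling algorithms for lattice gauge theory;
figures of merit are autocorrelation/cost numbers at stated couplings and volumes; no
continuum-physics claim.

Venture `LatticeQCDFlow` (cell pub-lqcd), topic `Exactness`; FANOUT row 13 (`eng-snf`, GEN-16).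
NEW WORK of the cell, not a published result; no definition is introduced; the only cited input is
Birkhoff's pointwise ergodic theorem, PROVED in the tree
(`Literature.Dynamics.Ergodic.birkhoff_ergodic_theorem_of_ergodic_holds`), used through
`NCMCGeneralSpaceErgodicRun.lean`.  Continuation of that file (generic strong laws along a
stationary ergodic stream of records) for the engine's objects: an ARBITRARY Crooks pair
`(κF, κR, s, e, W)` from `ν₀` to `ν₁` on a general measurable state space, `P_F = fwdPathLaw ν₀ κF`,
`P_R = fwdPathLaw ν₁ κR`, `e^{−ΔF} = Z₁/Z₀` (hypothesis `hΔF`).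

## Content

* `barSummand_strictMono`, `integral_barSummand_eq` — the per-pair Bennett summand
  `d ↦ σ(d − W p.1) − σ(W p.2 − d)` is strictly increasing, and its mean under ANY pair law with
  leg marginals `μF`, `μR` is the population gap `E_{μF} σ(d − W) − E_{μR} σ(W − d)` (the coupling of
  the two legs at equal index is irrelevant);
  **`tendsto_barRoot_ae_of_ergodic`** — along an ergodic stream of pairs with leg marginals `μF`,
  `μR`, every root sequence of the sample Bennett equation converges to the population root.
* **`CrooksPair.tendsto_jarzynskiEstimate_ae_of_ergodic`** — `ΔF̂_n → ΔF` a.s. along every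
  stationary ergodic stream of forward evolutions whose one-record marginal is `P_F`;
  **`CrooksPair.tendsto_reweighted_ae_of_ergodic`** — `Σ e^{−W_i} f(end_i) / Σ e^{−W_i} →
  (ν₁ Ω)⁻¹ ∫ f dν₁` a.s. (target means from a correlated equilibrium stream);
  **`CrooksPair.tendsto_barRoot_ae_of_ergodic`** / `…_measurable_barRoot_…` — the self-consistent
  Bennett estimate `→ ΔF` a.s. along an ergodic stream of (forward, reverse) pairs with leg
  marginals `P_F`, `P_R`.  (The Kish fraction needs no Crooks structure:
  `tendsto_essHat_ae_of_ergodic` of the parent file applies verbatim with `μ = P_F`.)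

Engine dictionary (`latflow-snf`): `run_ncmc_chain` / the Jarzynski lane with `n_between` sweeps of
the prior-level sampler between launches produces exactly such a stream when the level sampler is
started in equilibrium; the files say that `estimators.free_energy` (`dF`), `estimators.reweight`
and `estimators.bar` remain strongly consistent for it PROVIDED the stream is ergodic — a property
of the level sampler, not certified here.  NOT CLAIMED: ergodicity of any concrete sampler; error
bars / CLTs for correlated streams; anything about the NCMC (Metropolised) lane's occupancy chain.
-/

namespace Summit.Ventures.LatticeQCDFlow.Exactness.GeneralNCMC

open MeasureTheory ProbabilityTheory Set Filter Finset
open scoped ENNReal Topology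

variable {E : Type*} [MeasurableSpace E]

/-! ## The sample Bennett equation along an ergodic stream of (forward, reverse) record pairs -/

section Bar

variable {P : Measure (ℕ → E × E)} [IsProbabilityMeasure P] {μF μR : Measure E} {W : E → ℝ}

omit [MeasurableSpace E] in
/-- The per-pair Bennett summand `d ↦ σ(d − W p.1) − σ(W p.2 − d)` is strictly increasing. -/
theorem barSummand_strictMono (W : E → ℝ) (p : E × E) :
    StrictMono fun d : ℝ => Real.sigmoid (d - W p.1) - Real.sigmoid (W p.2 - d) := by
  intro c c' hcc'
  have h1 : Real.sigmoid (c - W p.1) < Real.sigmoid (c' - W p.1) :=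
    Real.sigmoid_strictMono (by linarith)
  have h2 : Real.sigmoid (W p.2 - c') < Real.sigmoid (W p.2 - c) :=
    Real.sigmoid_strictMono (by linarith)
  dsimp only
  linarith

/-- The population Bennett gap of a pair law is the difference of the two leg integrals, whatever the
coupling between the legs. -/
theorem integral_barSummand_eq (hW : Measurable W) (hF : P.map (fun ω => (ω 0).1) = μF)
    (hR : P.map (fun ω => (ω 0).2) = μR) (d : ℝ) :
    ∫ p, (Real.sigmoid (d - W p.1) - Real.sigmoid (W p.2 - d)) ∂(P.map fun ω => ω 0) =
      (∫ a, Real.sigmoid (d - W a) ∂μF) - ∫ a, Real.sigmoid (W a - d) ∂μR := by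
  haveI : IsProbabilityMeasure (P.map fun ω : ℕ → E × E => ω 0) :=
    Measure.isProbabilityMeasure_map (measurable_pi_apply 0).aemeasurable
  have hm1 : Measurable fun a : E => Real.sigmoid (d - W a) :=
    _root_.continuous_sigmoid.measurable.comp (measurable_const.sub hW)
  have hm2 : Measurable fun a : E => Real.sigmoid (W a - d) :=
    _root_.continuous_sigmoid.measurable.comp (hW.sub measurable_const)
  have hi1 : Integrable (fun p : E × E => Real.sigmoid (d - W p.1)) (P.map fun ω => ω 0) :=
    integrable_sigmoid_comp (measurable_const.sub (hW.comp measurable_fst))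
  have hi2 : Integrable (fun p : E × E => Real.sigmoid (W p.2 - d)) (P.map fun ω => ω 0) :=
    integrable_sigmoid_comp ((hW.comp measurable_snd).sub measurable_const)
  have e1 : ∫ p, Real.sigmoid (d - W p.1) ∂(P.map fun ω => ω 0) = ∫ a, Real.sigmoid (d - W a) ∂μF := by
    rw [integral_map (measurable_pi_apply 0).aemeasurable (hm1.comp measurable_fst).aestronglyMeasurable,
      ← hF, integral_map ((measurable_pi_apply 0).fst).aemeasurable hm1.aestronglyMeasurable]
  have e2 : ∫ p, Real.sigmoid (W p.2 - d) ∂(P.map fun ω => ω 0) = ∫ a, Real.sigmoid (W a - d) ∂μR := by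
    rw [integral_map (measurable_pi_apply 0).aemeasurable (hm2.comp measurable_snd).aestronglyMeasurable,
      ← hR, integral_map ((measurable_pi_apply 0).snd).aemeasurable hm2.aestronglyMeasurable]
  rw [integral_sub hi1 hi2, e1, e2]

/-- **Strong consistency of the self-consistent Bennett root along an ergodic stream of pairs.**  If
the stream of (forward record, reverse record) pairs is stationary and ergodic with one-pair leg
marginals `μF`, `μR`, and `d⋆` solves the population Bennett equation
`E_{μF} σ(d⋆ − W) = E_{μR} σ(W − d⋆)`, then outside one null set every sequence `d_n` solving the
sample equation `Σ_{i<n} σ(d_n − W_i) = Σ_{i<n} σ(W'_i − d_n)` for all large `n` converges to `d⋆`. -/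
theorem tendsto_barRoot_ae_of_ergodic (hP : Ergodic (fun (ω : ℕ → E × E) (k : ℕ) => ω (k + 1)) P)
    (hW : Measurable W) (hF : P.map (fun ω => (ω 0).1) = μF) (hR : P.map (fun ω => (ω 0).2) = μR)
    {dstar : ℝ} (hroot : ∫ a, Real.sigmoid (dstar - W a) ∂μF = ∫ a, Real.sigmoid (W a - dstar) ∂μR) :
    ∀ᵐ ω ∂P, ∀ dseq : ℕ → ℝ,
      (∀ᶠ n : ℕ in atTop, (∑ i ∈ range n, Real.sigmoid (dseq n - W (ω i).1)) -
        ∑ i ∈ range n, Real.sigmoid (W (ω i).2 - dseq n) = 0) →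
      Tendsto dseq atTop (𝓝 dstar) := by
  haveI : IsProbabilityMeasure (P.map fun ω : ℕ → E × E => ω 0) :=
    Measure.isProbabilityMeasure_map (measurable_pi_apply 0).aemeasurable
  have hint : ∀ d, Integrable (fun p : E × E => Real.sigmoid (d - W p.1) - Real.sigmoid (W p.2 - d))
      (P.map fun ω => ω 0) := fun d =>
    (integrable_sigmoid_comp (measurable_const.sub (hW.comp measurable_fst))).sub
      (integrable_sigmoid_comp ((hW.comp measurable_snd).sub measurable_const))
  have hroot' : ∫ p, (Real.sigmoid (dstar - W p.1) - Real.sigmoid (W p.2 - dstar))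
      ∂(P.map fun ω => ω 0) = 0 := by
    rw [integral_barSummand_eq hW hF hR, hroot, sub_self]
  have key := tendsto_root_ae_of_ergodic (ψ := fun d (p : E × E) =>
    Real.sigmoid (d - W p.1) - Real.sigmoid (W p.2 - d)) hP rfl (barSummand_strictMono W) hint hroot'
  filter_upwards [key] with ω hω dseq hdseq
  refine hω dseq ?_
  filter_upwards [hdseq] with n hn
  rw [← hn, sum_sub_distrib]

end Bar

/-! ## Crooks pairs: every point estimate of the engine is strongly consistent on ergodic streams -/

namespace CrooksPair

variable {Ω : Type*} [MeasurableSpace Ω]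
variable {ν₀ ν₁ : Measure Ω} {κF κR : Kernel Ω E} {s e : E → Ω} {W : E → ℝ}

/-- **`ΔF̂_n → ΔF` almost surely along a stationary ergodic stream of forward evolutions** whose
one-record marginal is the equilibrium path law `P_F` — for every Crooks pair on a general
measurable state space with `e^{−ΔF} = Z₁/Z₀`.  Independence of the evolutions is NOT needed. -/
theorem tendsto_jarzynskiEstimate_ae_of_ergodic [IsFiniteMeasure ν₀] [IsFiniteMeasure ν₁]
    [IsMarkovKernel κF] [IsMarkovKernel κR] (h0 : ν₀ univ ≠ 0) (h : CrooksPair ν₀ ν₁ κF κR s e W)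
    {ΔF : ℝ} (hΔF : Real.exp (-ΔF) = ((ν₀ univ)⁻¹ * ν₁ univ).toReal)
    {P : Measure (ℕ → E)} [IsProbabilityMeasure P]
    (hP : Ergodic (fun (ω : ℕ → E) (k : ℕ) => ω (k + 1)) P)
    (hμ : P.map (fun ω => ω 0) = fwdPathLaw ν₀ κF) :
    ∀ᵐ ω ∂P, Tendsto (fun n : ℕ => jarzynskiEstimate (fun ε => Real.exp (-W ε)) (fun i : Fin n => ω i))
      atTop (𝓝 ΔF) := by
  haveI := isProbabilityMeasure_fwdPathLaw ν₀ h0 κF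
  have key := GeneralNCMC.tendsto_jarzynskiEstimate_ae_of_ergodic hP hμ
    (w := fun ε => Real.exp (-W ε)) (fun ε => Real.exp_pos _) (h.integrable_exp_neg_work h0)
  rwa [h.integral_exp_neg_work, ← hΔF, Real.log_exp, neg_neg] at key

/-- **Reweighted end-point observables converge to their TARGET means along an ergodic stream**:
`Σ_{i<n} e^{−W_i} f(end_i) / Σ_{i<n} e^{−W_i} → (ν₁ Ω)⁻¹ ∫ f dν₁` a.s., for every measurable `f` with
`e^{−W} f(end) ∈ L¹(P_F)`. -/
theorem tendsto_reweighted_ae_of_ergodic [IsFiniteMeasure ν₀] [IsFiniteMeasure ν₁]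
    [IsMarkovKernel κF] [IsMarkovKernel κR] (h0 : ν₀ univ ≠ 0) (h1 : ν₁ univ ≠ 0)
    (h : CrooksPair ν₀ ν₁ κF κR s e W) {f : Ω → ℝ} (hfm : Measurable f)
    (hA : Integrable (fun ε => Real.exp (-W ε) * f (e ε)) (fwdPathLaw ν₀ κF))
    {P : Measure (ℕ → E)} [IsProbabilityMeasure P]
    (hP : Ergodic (fun (ω : ℕ → E) (k : ℕ) => ω (k + 1)) P)
    (hμ : P.map (fun ω => ω 0) = fwdPathLaw ν₀ κF) :
    ∀ᵐ ω ∂P, Tendsto (fun n : ℕ => (∑ i ∈ range n, Real.exp (-W (ω i)) * f (e (ω i))) /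
        ∑ i ∈ range n, Real.exp (-W (ω i))) atTop (𝓝 (((ν₁ univ)⁻¹).toReal * ∫ y, f y ∂ν₁)) := by
  haveI := isProbabilityMeasure_fwdPathLaw ν₀ h0 κF
  have hZ1 : (ν₁ univ).toReal ≠ 0 := (ENNReal.toReal_pos h1 (measure_ne_top ν₁ univ)).ne'
  have hZ0 : (ν₀ univ).toReal ≠ 0 := (ENNReal.toReal_pos h0 (measure_ne_top ν₀ univ)).ne'
  have hb0 : ∫ ε, Real.exp (-W ε) ∂(fwdPathLaw ν₀ κF) ≠ 0 := by
    rw [h.integral_exp_neg_work]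
    exact (toReal_ratio_pos h0 h1).ne'
  have key := GeneralNCMC.tendsto_ratio_ae_of_ergodic hP hμ hA (h.integrable_exp_neg_work h0) hb0
  have hlim : (∫ ε, Real.exp (-W ε) * f (e ε) ∂(fwdPathLaw ν₀ κF)) /
      ∫ ε, Real.exp (-W ε) ∂(fwdPathLaw ν₀ κF) = ((ν₁ univ)⁻¹).toReal * ∫ y, f y ∂ν₁ := by
    rw [h.integral_exp_neg_work_mul_comp_end hfm.aestronglyMeasurable, h.integral_exp_neg_work,
      ENNReal.toReal_mul, ENNReal.toReal_inv, ENNReal.toReal_inv]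
    field_simp
  rw [hlim] at key
  exact key

/-- **The BAR root converges to `ΔF` almost surely along an ergodic stream of (forward, reverse)
evolution pairs** whose one-pair leg marginals are `P_F` and `P_R` (the two legs may be coupled at
equal index in any way): every sequence solving the sample Bennett equation for all large `n`
tends to `ΔF`. -/
theorem tendsto_barRoot_ae_of_ergodic [IsFiniteMeasure ν₀] [IsFiniteMeasure ν₁]
    [IsMarkovKernel κF] [IsMarkovKernel κR] (h0 : ν₀ univ ≠ 0) (h1 : ν₁ univ ≠ 0)
    (h : CrooksPair ν₀ ν₁ κF κR s e W) {ΔF : ℝ}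
    (hΔF : Real.exp (-ΔF) = ((ν₀ univ)⁻¹ * ν₁ univ).toReal)
    {P : Measure (ℕ → E × E)} [IsProbabilityMeasure P]
    (hP : Ergodic (fun (ω : ℕ → E × E) (k : ℕ) => ω (k + 1)) P)
    (hF : P.map (fun ω => (ω 0).1) = fwdPathLaw ν₀ κF)
    (hR : P.map (fun ω => (ω 0).2) = fwdPathLaw ν₁ κR) :
    ∀ᵐ ω ∂P, ∀ dseq : ℕ → ℝ,
      (∀ᶠ n : ℕ in atTop, (∑ i ∈ range n, Real.sigmoid (dseq n - W (ω i).1)) -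
        ∑ i ∈ range n, Real.sigmoid (W (ω i).2 - dseq n) = 0) →
      Tendsto dseq atTop (𝓝 ΔF) := by
  haveI := isProbabilityMeasure_fwdPathLaw ν₀ h0 κF
  haveI := isProbabilityMeasure_fwdPathLaw ν₁ h1 κR
  exact GeneralNCMC.tendsto_barRoot_ae_of_ergodic hP h.measurable_W hF hR
    ((h.integral_sigmoid_fwd_eq_rev_iff h0 h1 hΔF ΔF).2 rfl)

/-- **The BAR estimator, as a random variable on the stream, converges to `ΔF` a.s.**: any root
selection `d̂_n` solving the sample equation for every `n ≥ 1` converges along almost every ergodic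
stream of pairs. -/
theorem tendsto_measurable_barRoot_ae_of_ergodic [IsFiniteMeasure ν₀] [IsFiniteMeasure ν₁]
    [IsMarkovKernel κF] [IsMarkovKernel κR] (h0 : ν₀ univ ≠ 0) (h1 : ν₁ univ ≠ 0)
    (h : CrooksPair ν₀ ν₁ κF κR s e W) {ΔF : ℝ}
    (hΔF : Real.exp (-ΔF) = ((ν₀ univ)⁻¹ * ν₁ univ).toReal)
    {P : Measure (ℕ → E × E)} [IsProbabilityMeasure P]
    (hP : Ergodic (fun (ω : ℕ → E × E) (k : ℕ) => ω (k + 1)) P)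
    (hF : P.map (fun ω => (ω 0).1) = fwdPathLaw ν₀ κF)
    (hR : P.map (fun ω => (ω 0).2) = fwdPathLaw ν₁ κR) {dhat : ℕ → (ℕ → E × E) → ℝ}
    (hdhat : ∀ n, 1 ≤ n → ∀ ω, (∑ i ∈ range n, Real.sigmoid (dhat n ω - W (ω i).1)) -
      ∑ i ∈ range n, Real.sigmoid (W (ω i).2 - dhat n ω) = 0) :
    ∀ᵐ ω ∂P, Tendsto (fun n => dhat n ω) atTop (𝓝 ΔF) := by
  filter_upwards [h.tendsto_barRoot_ae_of_ergodic h0 h1 hΔF hP hF hR] with ω hω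
  exact hω (fun n => dhat n ω) (eventually_atTop.2 ⟨1, fun n hn => hdhat n hn ω⟩)

end CrooksPair

end Summit.Ventures.LatticeQCDFlow.Exactness.GeneralNCMC
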